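import Summits.BirchSwinnertonDyer.BirchSwinnertonDyer.Theorems.CMKolyvaginAtInertTwoCMKolyvaginConjectureAtInertTwoTwistCoordinatesAllLevels
import Summits.BirchSwinnertonDyer.BirchSwinnertonDyer.Theses.CMKolyvaginAtInertTwo
import HarnessLib

/-!
# Crux `CMKolyvaginConjectureAtInertTwo` (stmt-BirchSwinnertonDyer-24648) BY NAME ⟺ the TWIST DICHOTOMY:
# on every H₂ frame, `y_K ∉ 2E(K[1])`, or at some square-free CM-inert Kolyvagin level `n` the genus trace is not twice
# the transport of a `K[1]`-point of the quadratic twist `E^{(n*)}`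

Route `CMKolyvaginAtInertTwo` (cell `pub/bsd-eis`, seat `leafhand-bsd-cmkolyvaginatinert-3` g0); helper (`--supports
stmt-BirchSwinnertonDyer-24648 --as helper`). THEOREMS ONLY (no definition, no named fact, no `sorry`); closes nothing.

Capstone of the seat's twist dictionary (`…TwistCoordinatesAllLevels`, p822661): the route decl
`Summit.BirchSwinnertonDyer.BirchSwinnertonDyer.Theses.CMKolyvaginAtInertTwo.CMKolyvaginConjectureAtInertTwo` is EQUIVALENT to
the statement that on every H₂ frame either `P(1) = y_K` is not `2`-divisible in `E(K[1])` (depth `0`, the landed `stub_levelOne`)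
or there are a square-free `n` whose prime factors are CM-inert Zhang–Kolyvagin primes at `2` and a datum `d` of conductor `n`
such that for EVERY `Θ ∈ K[n]` with `Θ ≠ 0` and `σ_ℓ Θ = −Θ` (`ℓ ∣ n`) — such `Θ` exist with `Θ² = n*`,
`exists_prod_sqrt_of_isKolyvaginPrime` — the genus trace `G_d = Σ_{s∈S} s(𝒩_n y(n))` is NOT of the form `2Q` with `Q = O` or
`Q = (x, y)`, `x ∈ K[1]`, `(2y + a₁x + a₃)/Θ ∈ K[1]` (i.e. `Q` the transport of a `K[1]`-point `(x, w)` of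
`E^{(n*)} : n*w² = 4x³ + b₂x² + 2b₄x + b₆`). This is the open stub `stub_positiveDepth` (= GT∀ of the cell's censuses) in
Mordell–Weil language: a level-ONE `2`-indivisibility on ONE quadratic twist per level.

HONEST FRAMING: a by-name repackaging of landed theorems; nothing is closed; BSD is proved for no curve. Beyond-print: no.
References: [cite: GrossLMS1991, §3 (3.5), Prop. 3.7 (1), §4 (4.1)] [cite: SilvermanAEC2009, X.5 Cor. 5.4] [cite: Cox2013, §9.A].
-/

set_option linter.dupNamespace false -- `Summit.BirchSwinnertonDyer.BirchSwinnertonDyer.Theorems.…` (summit = sub)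
set_option autoImplicit false

noncomputable section

open scoped Classical

namespace Summit.BirchSwinnertonDyer.BirchSwinnertonDyer.Theorems.CMKolyvaginConjecturePositiveDepth

open Finset WeierstrassCurve NumberField
open Literature.NumberTheory.EllipticCurves Literature.NumberTheory.EllipticCurves.ModularForms
open Literature.NumberTheory.EllipticCurves.Rank1Residual
open Summit.BirchSwinnertonDyer.BirchSwinnertonDyer.Theses.CMKolyvaginAtInertTwo (CMKolyvaginConjectureAtInertTwo)

/-- **Crux 24648 BY NAME ⟺ the twist dichotomy** (see the module docstring).
[cite: GrossLMS1991, §3 (3.5), Prop. 3.7 (1), §4 (4.1)] [cite: SilvermanAEC2009, X.5 Cor. 5.4] [cite: Cox2013, §9.A] -/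
theorem cmKolyvaginConjectureAtInertTwo_iff_twistDichotomy :
    CMKolyvaginConjectureAtInertTwo ↔
    ∀ (W : WeierstrassCurve ℚ) [W.IsElliptic] [W.IsGloballyMinimal] [NeZero (W.conductorNorm ℤ)], W.HasCM →
      Literature.NumberTheory.EllipticCurves.Rank1Residual.CMInert W 2 → W.HasSurjectiveModNGaloisRep (2 : ℤ) →
      W.analyticRank = 1 → Odd W.tamagawaProduct → ∀ (K : Type) [Field K] [NumberField K],
      Literature.NumberTheory.EllipticCurves.IsImaginaryQuadratic K → Odd (NumberField.discr K) → NumberField.discr K ≠ -3 →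
      Literature.NumberTheory.EllipticCurves.SatisfiesHeegnerHypothesis (W.conductorNorm ℤ) K →
      ∀ (Dt : Literature.NumberTheory.EllipticCurves.ModularForms.ModularParametrizationData W (W.conductorNorm ℤ)),
      (∀ z ∈ Dt.L.lattice, ∃ w ∈ Literature.NumberTheory.EllipticCurves.ModularForms.periodLattice Dt.f, z = (Dt.c : ℂ) * w) →
      Odd Dt.c → ∀ (β : ℤ) (ι : K →+* ℂ) (d₁ : Literature.NumberTheory.EllipticCurves.KolyvaginHeegnerData Dt β ι 1),
      ¬ IsOfFinAddOrder d₁.derivedPoint →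
      (¬ ∃ Q : (W.baseChange (ringClassField K ι 1)).toAffine.Point, (2 : ℤ) • Q = d₁.derivedPoint) ∨
      ∃ (n : ℕ) (d : KolyvaginHeegnerData Dt β ι n), Squarefree n ∧
        (∀ ℓ ∈ n.primeFactors, (Zhang2014.IsKolyvaginPrime (W.conductorNorm ℤ) W K 2 ℓ ∧ CMInert W ℓ)) ∧
        ∀ Θ : ringClassField K ι n, Θ ≠ 0 → (∀ ℓ ∈ n.primeFactors, d.σ ℓ Θ = -Θ) →
          ¬ ∃ Q : (W.baseChange (ringClassField K ι n)).toAffine.Point,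
            (2 : ℤ) • Q = ∑ s ∈ d.S, pointGalHom W (ringClassField K ι n) s
                (n.primeFactorsList.foldr
                  (fun q x ↦ ∑ k ∈ range ((q + 1) / 2), pointGalHom W (ringClassField K ι n) ((d.σ q ^ 2) ^ k) x) d.y) ∧
            ∀ (x y : ringClassField K ι n) (h : (W.baseChange (ringClassField K ι n)).toAffine.Nonsingular x y),
              Q = .some x y h →
                (x : ℂ) ∈ ringClassField K ι 1 ∧
                  (((2 * y + (W.baseChange (ringClassField K ι n)).toAffine.a₁ * x +
                      (W.baseChange (ringClassField K ι n)).toAffine.a₃) / Θ : ringClassField K ι n) : ℂ) ∈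
                    ringClassField K ι 1 := by
  constructor
  · intro hKC W _ _ _ hCM hin hρ hr hT K _ _ hK hodd h3 hH Dt hDt hc β ι d₁ hy
    by_cases h2 : ∃ Q : (W.baseChange (ringClassField K ι 1)).toAffine.Point, (2 : ℤ) • Q = d₁.derivedPoint
    · obtain ⟨n, d, hn, hKol, hP⟩ := hKC W hCM hin hρ hr hT K hK hodd h3 hH Dt hDt hc β ι d₁ hy
      refine Or.inr ⟨n, d, hn, hKol, fun Θ hΘ hΘneg hQ ↦ hP ?_⟩
      exact (two_dvd_derivedPoint_iff_exists_twistCoords_allLevels W hCM hin hρ hK hodd h3 hH hn hKol d hΘ hΘneg).mpr hQ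
    · exact Or.inl h2
  · intro h W _ _ _ hCM hin hρ hr hT K _ _ hK hodd h3 hH Dt hDt hc β ι d₁ hy
    rcases h W hCM hin hρ hr hT K hK hodd h3 hH Dt hDt hc β ι d₁ hy with h0 | ⟨n, d, hn, hKol, hG⟩
    · exact ⟨1, d₁, squarefree_one, fun ℓ hℓ ↦ absurd hℓ (by simp), h0⟩
    · obtain ⟨Θ, -, hΘ, hΘneg⟩ := exists_prod_sqrt_of_isKolyvaginPrime hK W hn (fun ℓ hℓ ↦ (hKol ℓ hℓ).1) d
      refine ⟨n, d, hn, hKol, fun hP ↦ hG Θ hΘ hΘneg ?_⟩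
      exact (two_dvd_derivedPoint_iff_exists_twistCoords_allLevels W hCM hin hρ hK hodd h3 hH hn hKol d hΘ hΘneg).mp hP

end Summit.BirchSwinnertonDyer.BirchSwinnertonDyer.Theorems.CMKolyvaginConjecturePositiveDepth

end
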